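import Summits.QuantumFields.YangMills.Theorems.UnitScaleTiltProp7TwistedOneStepLinL1OfPlaqSmall
import Summits.QuantumFields.YangMills.Theorems.UnitScaleTiltProp8ChartKernelTube
import HarnessLib

/-!
# Route `UnitScaleTilt`, crux K1 «MinimiserStabilityRegPr» (stmt-QuantumFields-19200), EX display row (157)-twˢ `hC157` (S16ᴰ ⟸ ✓`Prop7CcolOf157Entry.hCcol_of_157_family`),
# C-ENTRY line, file F-2 — **THE COVARIANT ONE-STEP LINEARISATION SPLITS AS A UNITARILY CONJUGATED STRAIGHT TUBE PLUS A BACKGROUND-SMALL LEAK, IN SUP CURRENCY**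
# ([Balaban1985Averaging] (124)∕(139) «Q(V₀)A = Q_{V₀}A + Q″(V₀)A, |Q_{V₀}A| ≦ Q|A|, |Q″(V₀)A| ≦ C′₁α(V₀)·Q″|A|» p.36∕p.39, for the symmetric one-step double bar `dbarCovU`)

Cell `ym3-torus` (HUMAN RULING D-0037: YM₃ on T³ is ladder rung R3, not the Clay problem), width seat `ym3-torus-px18` gen 3; ★w2-19200 g8 03:19:50Z «C-ENTRY GO — F-2 next,
SIGNATURE first» (bus 04:2xZ).  `--supports stmt-QuantumFields-19200 --as helper`; def-free, 0 sorry; count-neutral.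

LETTERS (★routeR-w3 g7 FILE B∕C∕D + ★routeR-w6 g7 COV-GAUGE, VERBATIM).  Level `j`, background `V₀`, chart `f(A) := log[U̿(V₀; e^{A}V₀)(c)·Ū(V₀)(c)⁻¹]` at the coarse bond `c`,
a norm-`≤ 1` gauge `û` (norm-`≤ 1` inverse) making `V₀^{û}` `s_B`-flat on the two blocks of `c`, budgets `10⁷ℓ²ρ ≤ 1`, `4s_B < ρ`; `Ad_û Y(b) := û(b₋)Y(b)û(b₋)⁻¹`; THE CONJUGATED
TUBE `T♭Y := û(emb c₋)⁻¹·(L·Q(Ad_û Y))(c)·û(emb c₋)` (`Q = bondAvg`).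
§1 (generic `M_n(ℂ)`): ★★★ `norm_fderiv_chart_sub_conjTube_le` — `‖Df(0)Y − T♭Y‖ ≤ 16(12Lρ)∕ρ²·(2s_B)·‖Y‖` (print's `Q″(V₀)`; ✓`differentiableAt_dbarLogRel_zero`.2 ∘
✓`fderiv_flatDbarChart_zero_apply`); `norm_conjTube_le_smul_bondAvg_norm` — `‖T♭Y‖ ≤ L·Q(‖Y‖)(c)` (the POSITIVE flat majorant «|Q_{V₀}A| ≦ Q|A|», unitarity), `norm_conjTube_le_mul_sup`
(`≤ L‖Y‖`), `norm_conjTube_le_of_endpoint` (`≤ 2L(Lᵈ)⁻¹β′` on the readers of a site: the `hT` of ✓`LeakyLinearTower.leaky_tower_bound`, `Θ = 2`, `λ = L^{1−d}`),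
`norm_fderiv_chart_le_mul_sup` (`‖Df(0)Y‖ ≤ (L + c_R)‖Y‖`, orbit growth), `norm_fderiv_chart_le_of_endpoint` (`≤ (2L(Lᵈ)⁻¹ + c_R)β′`: the `hT`∕`θ₀` of ✓`ChartKernelTower.kernel_tower_bound_le`),
`norm_fderiv_chart_sub_conjTube_le_sum` (the leak in the ℓ¹ form of ✓`leaky_tower_bound`'s `hR`, `c_R := 16(12Lρ)∕ρ²(2s_B)`).
§2 (SU(2), the tower `Ū₀ˡ = emlIterU l U₀♭` of a `PlaqSmall a₀ U₀` background in ★routeR-w6's cluster axial gauges `û_c := transfUp (axialT U₀ (embIter (l+1) c₋))♭ l`, `s_B := s₀(l) =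
30ℓLˡ·2d(3L^{l+1} − 1)a₀`, budgets VERBATIM from ✓`sum_norm_fderiv_dbarChartField_apply_le_of_plaqSmall`; FIELD-VALUED `fderiv` as in F0″∕FILE D): `fderiv_chartField_apply_eq_of_plaqSmall`,
★★ `norm_fderiv_chartField_apply_sub_conjTube_le_of_plaqSmall`, `…_le_mul_sup_of_plaqSmall`, `…_le_of_endpoint_of_plaqSmall`, `…_sub_conjTube_le_sum_of_plaqSmall`.  At the member
(`a₀ = ε₀L^{−2(K−n)}`) `s₀(l) ≤ 180dℓL·ε₀·(L⁻²)^{(K−n)−1−l}`: the leak is GEOMETRIC toward the bottom with ratio `θ = L⁻²` (F-1's `hcRν`).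
HONEST SCOPE.  Instantiation∕bookkeeping over landed bricks; constants crude (Cauchy route, `1∕ρ = 10⁷ℓ²`); orbit sizes, (148) at the orbit, the tower assembly and the T³ reading of
`hC157` are the NEXT files (F-3∕F-4∕F-5); nothing of `hC157`, EX, E′ or the crux is claimed; rung R3, not d = 4; YM gap NOT proved.

References: T. Bałaban, CMP **98** (1985) 17–51 [Balaban1985Averaging] ((11)–(12) p.19, (124)–(127) p.36, (139)–(143) p.39, (147)–(152) p.40, (161)–(163) p.42); CMP **95** (1984)
17–40 [Balaban1984PropagatorsI] ((1.11), (1.18)–(1.20) pp.19–20).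
-/

noncomputable section

open scoped BigOperators Matrix.Norms.L2Operator
open NormedSpace Metric Set Finset

namespace Summit.QuantumFields.YangMills.Theorems.Prop7CovKernelOneStep

open Literature.MathematicalPhysics.QuantumFieldTheory.Balaban1983to89
open T4Continuum BlockAveraging AveragingRT ExpMeanLog LatticeFieldCalculus
open B15DeterminingSets (embIter)
open B7Prop1Explicit (expUnit val_expUnit U1 mem_U1)
open MatrixLog (mlog)
open B10Eq27TorusAxialLog (axialT gaugeActT gaugeActT_apply unitsField toUField suIncl)
open Summit.QuantumFields.YangMills.Theorems.Prop8Chart (emlAvgU emlIterU)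
open Summit.QuantumFields.YangMills.Theorems.Prop8ChartDoubleBar (dbarAvgU)
open Summit.QuantumFields.YangMills.Theorems.Prop7SymAvgTwSym (dbarCovU)
open Summit.QuantumFields.YangMills.Theorems.Prop7DbarLinCovDefect (differentiableAt_dbarLogRel_zero norm_adField_le)
open Summit.QuantumFields.YangMills.Theorems.Prop7TwistedOneStepLinL1 (fderiv_flatDbarChart_zero_apply norm_bondAvg_le_bondAvg_norm bondAvg_mono bondAvg_nonneg)
open Summit.QuantumFields.YangMills.Theorems.Prop7TwistedOneStepDefectCovGauge (transfUp_toUnits_mem_U1 norm_bgTower_gauged_sub_one_le_of_plaqSmall)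
open Summit.QuantumFields.YangMills.Theorems.Prop7TwistedOneStepLinL1OfPlaqSmall (norm_transfUp_toUnits_le_one)
open Summit.QuantumFields.BalabanUV.T4Continuum (NE9RelativeChartPlaquette.norm_conj_le)
open Summit.QuantumFields.YangMills.Theorems.ChartKernelTube (norm_tube_le_of_endpoint)

variable {P : Params} {j : ℕ}

/-! ## §1 Generic level: the conjugated tube and the leak -/

section Generic

variable {n : Type*} [Fintype n] [DecidableEq n] [Nonempty n]

omit [Nonempty n] in
/-- `Q(const a)(c) = a`: the straight-tube average of a constant bond field (`L^{−(d+1)}·Lᵈ·L·a`). [cite: Balaban1984PropagatorsI, (1.11) p.19] -/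
theorem bondAvg_const' (a : ℝ) (c : PBond P (j + 1)) : bondAvg (fun _ : PBond P j => a) c = a := by
  unfold bondAvg segSum
  simp only [Finset.sum_const, Finset.card_range, Finset.card_univ, Fintype.card_fun, Fintype.card_fin, smul_eq_mul, nsmul_eq_mul]
  have hL : (P.L : ℝ) ≠ 0 := Nat.cast_ne_zero.mpr P.L_pos.ne'
  rw [pow_succ]
  push_cast
  field_simp

omit [Nonempty n] in
/-- `‖u⁻¹·X·u‖ ≤ ‖X‖` for norm-`≤ 1` `u`, `u⁻¹`. [folklore] -/
theorem norm_invConj_le {u : (Matrix n n ℂ)ˣ} (hu : ‖(u : Matrix n n ℂ)‖ ≤ 1) (hu' : ‖((u⁻¹ : (Matrix n n ℂ)ˣ) : Matrix n n ℂ)‖ ≤ 1) (X : Matrix n n ℂ) :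
    ‖((u⁻¹ : (Matrix n n ℂ)ˣ) : Matrix n n ℂ) * X * (u : Matrix n n ℂ)‖ ≤ ‖X‖ := by
  calc _ ≤ ‖((u⁻¹ : (Matrix n n ℂ)ˣ) : Matrix n n ℂ)‖ * ‖X‖ * ‖(u : Matrix n n ℂ)‖ :=
        (norm_mul_le _ _).trans (mul_le_mul_of_nonneg_right (norm_mul_le _ _) (norm_nonneg _))
    _ ≤ 1 * ‖X‖ * 1 := mul_le_mul (mul_le_mul_of_nonneg_right hu' (norm_nonneg _)) hu (norm_nonneg _) (by positivity)
    _ = ‖X‖ := by ring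

omit [Nonempty n] in
/-- **THE CONJUGATED TUBE UNDER ITS POSITIVE FLAT MAJORANT**: `‖û(e)⁻¹·(L·Q(Ad_û Y))(c)·û(e)‖ ≤ L·Q(‖Y‖)(c)` for norm-`≤ 1` `û`, `û⁻¹` — print's «|Q_{V₀}A| ≦ Q|A|» (124) p.36
(unitarity of the transporters; ✓`norm_bondAvg_le_bondAvg_norm`, ✓`bondAvg_mono`). [cite: Balaban1985Averaging, (124) p.36; Balaban1984PropagatorsI, (1.11) p.19] -/
theorem norm_conjTube_le_smul_bondAvg_norm (û : GaugeTransf P j (Matrix n n ℂ)ˣ)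
    (hû : ∀ x, ‖((û x : (Matrix n n ℂ)ˣ) : Matrix n n ℂ)‖ ≤ 1) (hû' : ∀ x, ‖(((û x)⁻¹ : (Matrix n n ℂ)ˣ) : Matrix n n ℂ)‖ ≤ 1)
    (e : Site P j) (Y : PBond P j → Matrix n n ℂ) (c : PBond P (j + 1)) :
    ‖(((û e)⁻¹ : (Matrix n n ℂ)ˣ) : Matrix n n ℂ) *
        (((P.L : ℕ) : ℂ) • bondAvg (fun b : PBond P j => ((û b.src : (Matrix n n ℂ)ˣ) : Matrix n n ℂ) * Y b * (((û b.src)⁻¹ : (Matrix n n ℂ)ˣ) : Matrix n n ℂ)) c) *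
        ((û e : (Matrix n n ℂ)ˣ) : Matrix n n ℂ)‖ ≤ (P.L : ℝ) * bondAvg (fun b => ‖Y b‖) c := by
  set Z : PBond P j → Matrix n n ℂ := fun b => ((û b.src : (Matrix n n ℂ)ˣ) : Matrix n n ℂ) * Y b * (((û b.src)⁻¹ : (Matrix n n ℂ)ˣ) : Matrix n n ℂ) with hZ
  have hZb : ∀ b, ‖Z b‖ ≤ ‖Y b‖ := fun b => NE9RelativeChartPlaquette.norm_conj_le (hû b.src) (hû' b.src)
  have hin : ‖((P.L : ℕ) : ℂ) • bondAvg Z c‖ ≤ (P.L : ℝ) * bondAvg (fun b => ‖Y b‖) c := by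
    rw [norm_smul, Complex.norm_natCast]
    exact mul_le_mul_of_nonneg_left ((norm_bondAvg_le_bondAvg_norm Z c).trans (bondAvg_mono hZb c)) (Nat.cast_nonneg _)
  exact (norm_invConj_le (hû e) (hû' e) _).trans hin

omit [Nonempty n] in
/-- `‖T♭Y‖ ≤ L·‖Y‖` (the positive majorant on the constant field `‖Y‖`: `Q1 = 1`). [cite: Balaban1985Averaging, (124) p.36; Balaban1984PropagatorsI, (1.11) p.19] -/
theorem norm_conjTube_le_mul_sup (û : GaugeTransf P j (Matrix n n ℂ)ˣ)
    (hû : ∀ x, ‖((û x : (Matrix n n ℂ)ˣ) : Matrix n n ℂ)‖ ≤ 1) (hû' : ∀ x, ‖(((û x)⁻¹ : (Matrix n n ℂ)ˣ) : Matrix n n ℂ)‖ ≤ 1)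
    (e : Site P j) (Y : PBond P j → Matrix n n ℂ) (c : PBond P (j + 1)) :
    ‖(((û e)⁻¹ : (Matrix n n ℂ)ˣ) : Matrix n n ℂ) *
        (((P.L : ℕ) : ℂ) • bondAvg (fun b : PBond P j => ((û b.src : (Matrix n n ℂ)ˣ) : Matrix n n ℂ) * Y b * (((û b.src)⁻¹ : (Matrix n n ℂ)ˣ) : Matrix n n ℂ)) c) *
        ((û e : (Matrix n n ℂ)ˣ) : Matrix n n ℂ)‖ ≤ (P.L : ℝ) * ‖Y‖ := by
  refine (norm_conjTube_le_smul_bondAvg_norm û hû hû' e Y c).trans (mul_le_mul_of_nonneg_left ?_ (Nat.cast_nonneg _))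
  calc bondAvg (fun b => ‖Y b‖) c ≤ bondAvg (fun _ : PBond P j => ‖Y‖) c := bondAvg_mono (fun b => norm_le_pi_norm Y b) c
    _ = ‖Y‖ := bondAvg_const' ‖Y‖ c

omit [Nonempty n] in
/-- **THE CONJUGATED TUBE ON THE READERS OF A SITE: `Θ·λ = 2·L·L^{−d}`** — for `Y` vanishing off a finite set `S` of level-`j` bonds all having the site `β` as an endpoint and
`‖Y‖ ≤ β′` on `S`: `‖T♭Y‖ ≤ 2L(Lᵈ)⁻¹·β′` (✓`ChartKernelTube.norm_tube_le_of_endpoint` on `Ad_û Y`, which has the same support and sup; unitarity outside).  The `hT` letter of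
✓`LeakyLinearTower.leaky_tower_bound` (`Θ := 2`, `λ := L^{1−d}`). [cite: Balaban1985Averaging, (142) p.39, (147) p.40, (154) p.41] -/
theorem norm_conjTube_le_of_endpoint (hj : j + 1 ≤ P.m + P.K) (û : GaugeTransf P j (Matrix n n ℂ)ˣ)
    (hû : ∀ x, ‖((û x : (Matrix n n ℂ)ˣ) : Matrix n n ℂ)‖ ≤ 1) (hû' : ∀ x, ‖(((û x)⁻¹ : (Matrix n n ℂ)ˣ) : Matrix n n ℂ)‖ ≤ 1)
    (e : Site P j) (βs : Site P j) (S : Finset (PBond P j)) (hS : ∀ c' ∈ S, c'.src = βs ∨ c'.tgt = βs)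
    (Y : PBond P j → Matrix n n ℂ) (hY : ∀ c', c' ∉ S → Y c' = 0) {β' : ℝ} (hβ' : 0 ≤ β') (hYβ : ∀ c' ∈ S, ‖Y c'‖ ≤ β') (c : PBond P (j + 1)) :
    ‖(((û e)⁻¹ : (Matrix n n ℂ)ˣ) : Matrix n n ℂ) *
        (((P.L : ℕ) : ℂ) • bondAvg (fun b : PBond P j => ((û b.src : (Matrix n n ℂ)ˣ) : Matrix n n ℂ) * Y b * (((û b.src)⁻¹ : (Matrix n n ℂ)ˣ) : Matrix n n ℂ)) c) *
        ((û e : (Matrix n n ℂ)ˣ) : Matrix n n ℂ)‖ ≤ 2 * (P.L : ℝ) * ((P.L : ℝ) ^ P.d)⁻¹ * β' := by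
  set Z : PBond P j → Matrix n n ℂ := fun b => ((û b.src : (Matrix n n ℂ)ˣ) : Matrix n n ℂ) * Y b * (((û b.src)⁻¹ : (Matrix n n ℂ)ˣ) : Matrix n n ℂ) with hZ
  have hZ0 : ∀ c', c' ∉ S → Z c' = 0 := fun c' hc' => by simp only [hZ, hY c' hc', mul_zero, zero_mul]
  have hZβ : ∀ c' ∈ S, ‖Z c'‖ ≤ β' := fun c' hc' => (NE9RelativeChartPlaquette.norm_conj_le (hû c'.src) (hû' c'.src)).trans (hYβ c' hc')
  have ht := norm_tube_le_of_endpoint hj βs S hS Z hZ0 hβ' hZβ c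
  have hsm : ((P.L : ℕ) : ℂ) • bondAvg Z c = (P.L : ℝ) • bondAvg Z c := by
    rw [← Complex.coe_smul, Complex.ofReal_natCast]
  refine (norm_invConj_le (hû e) (hû' e) _).trans ?_
  rw [hsm]; exact ht

/-- ★★★ **(124)∕(139)-twˢ IN SUP CURRENCY — THE LINEARISED COVARIANT ONE STEP IS THE CONJUGATED TUBE UP TO A BACKGROUND-SMALL LEAK.**  Level `j`, background `V₀`, coarse bond `c`, a
norm-`≤ 1` gauge `û` (norm-`≤ 1` inverse) making `V₀^{û}` `s_B`-flat on the two blocks of `c`, budgets `10⁷ℓ²ρ ≤ 1`, `0 ≤ s_B`, `4s_B < ρ`.  Then for every direction `Y`: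
`‖D(A ↦ log[U̿(V₀; e^{A}V₀)(c)·Ū(V₀)(c)⁻¹])(0)·Y − û(emb c₋)⁻¹·(L·Q(Ad_û Y))(c)·û(emb c₋)‖ ≤ 16·(12Lρ)∕ρ²·(2s_B)·‖Y‖` — print's `Q″(V₀)` term with `α(V₀) ↔ s_B`
(✓`differentiableAt_dbarLogRel_zero` by joint analyticity + Schwarz, ✓`fderiv_flatDbarChart_zero_apply` `= L·Q`). [cite: Balaban1985Averaging, (124)-(127) p.36, (139) p.39] -/
theorem norm_fderiv_chart_sub_conjTube_le (hj : j + 1 ≤ P.m + P.K) (c : PBond P (j + 1)) (V₀ : GaugeField P j (Matrix n n ℂ)ˣ)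
    (û : GaugeTransf P j (Matrix n n ℂ)ˣ)
    (hû : ∀ x, ‖((û x : (Matrix n n ℂ)ˣ) : Matrix n n ℂ)‖ ≤ 1) (hû' : ∀ x, ‖(((û x)⁻¹ : (Matrix n n ℂ)ˣ) : Matrix n n ℂ)‖ ≤ 1) {sB ρ : ℝ} (hρ0 : 0 < ρ)
    (hbudget : 10000000 * (((P.d + 2) * P.L : ℕ) : ℝ) ^ 2 * ρ ≤ 1) (hsB0 : 0 ≤ sB) (hsB : 4 * sB < ρ)
    (hV : ∀ b : PBond P j, (blockOf b.src = c.src ∨ blockOf b.src = c.tgt) → (blockOf b.tgt = c.src ∨ blockOf b.tgt = c.tgt) →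
      ‖((gaugeActT û V₀ b : (Matrix n n ℂ)ˣ) : Matrix n n ℂ) - 1‖ ≤ sB)
    (Y : PBond P j → Matrix n n ℂ) :
    ‖fderiv ℂ (fun A : PBond P j → Matrix n n ℂ =>
          mlog (((dbarCovU V₀ (fun b => expUnit (A b) * V₀ b) c : (Matrix n n ℂ)ˣ) : Matrix n n ℂ) * (((emlAvgU V₀ c)⁻¹ : (Matrix n n ℂ)ˣ) : Matrix n n ℂ))) 0 Y -
        (((û (emb c.src))⁻¹ : (Matrix n n ℂ)ˣ) : Matrix n n ℂ) *
          (((P.L : ℕ) : ℂ) • bondAvg (fun b : PBond P j => ((û b.src : (Matrix n n ℂ)ˣ) : Matrix n n ℂ) * Y b * (((û b.src)⁻¹ : (Matrix n n ℂ)ˣ) : Matrix n n ℂ)) c) *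
          ((û (emb c.src) : (Matrix n n ℂ)ˣ) : Matrix n n ℂ)‖ ≤
      16 * (12 * (P.L : ℝ) * ρ) / ρ ^ 2 * (2 * sB) * ‖Y‖ := by
  have h := (differentiableAt_dbarLogRel_zero hj c V₀ û hû hû' hρ0 hbudget hsB0 hsB hV).2 Y
  rw [fderiv_flatDbarChart_zero_apply] at h
  exact h

/-- **THE FULL SUP LETTER (orbit growth)**: `‖Df(0)Y‖ ≤ (L + 16(12Lρ)∕ρ²(2s_B))·‖Y‖`. [cite: Balaban1985Averaging, (124)-(127) p.36, (139) p.39] -/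
theorem norm_fderiv_chart_le_mul_sup (hj : j + 1 ≤ P.m + P.K) (c : PBond P (j + 1)) (V₀ : GaugeField P j (Matrix n n ℂ)ˣ)
    (û : GaugeTransf P j (Matrix n n ℂ)ˣ)
    (hû : ∀ x, ‖((û x : (Matrix n n ℂ)ˣ) : Matrix n n ℂ)‖ ≤ 1) (hû' : ∀ x, ‖(((û x)⁻¹ : (Matrix n n ℂ)ˣ) : Matrix n n ℂ)‖ ≤ 1) {sB ρ : ℝ} (hρ0 : 0 < ρ)
    (hbudget : 10000000 * (((P.d + 2) * P.L : ℕ) : ℝ) ^ 2 * ρ ≤ 1) (hsB0 : 0 ≤ sB) (hsB : 4 * sB < ρ)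
    (hV : ∀ b : PBond P j, (blockOf b.src = c.src ∨ blockOf b.src = c.tgt) → (blockOf b.tgt = c.src ∨ blockOf b.tgt = c.tgt) →
      ‖((gaugeActT û V₀ b : (Matrix n n ℂ)ˣ) : Matrix n n ℂ) - 1‖ ≤ sB)
    (Y : PBond P j → Matrix n n ℂ) :
    ‖fderiv ℂ (fun A : PBond P j → Matrix n n ℂ =>
          mlog (((dbarCovU V₀ (fun b => expUnit (A b) * V₀ b) c : (Matrix n n ℂ)ˣ) : Matrix n n ℂ) * (((emlAvgU V₀ c)⁻¹ : (Matrix n n ℂ)ˣ) : Matrix n n ℂ))) 0 Y‖ ≤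
      ((P.L : ℝ) + 16 * (12 * (P.L : ℝ) * ρ) / ρ ^ 2 * (2 * sB)) * ‖Y‖ := by
  have h1 := norm_fderiv_chart_sub_conjTube_le hj c V₀ û hû hû' hρ0 hbudget hsB0 hsB hV Y
  have h2 := norm_conjTube_le_mul_sup û hû hû' (emb c.src) Y c
  calc _ = ‖(_ - _) + _‖ := by rw [sub_add_cancel]
    _ ≤ ‖_ - _‖ + ‖_‖ := norm_add_le _ _
    _ ≤ 16 * (12 * (P.L : ℝ) * ρ) / ρ ^ 2 * (2 * sB) * ‖Y‖ + (P.L : ℝ) * ‖Y‖ := add_le_add h1 h2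
    _ = ((P.L : ℝ) + 16 * (12 * (P.L : ℝ) * ρ) / ρ ^ 2 * (2 * sB)) * ‖Y‖ := by ring

omit [Nonempty n] in
/-- A field vanishing off `S` and `≤ β′` on `S` has sup norm `≤ β′` (`0 ≤ β′`). [folklore] -/
theorem pi_norm_le_of_vanish {ι : Type*} [Fintype ι] (S : Finset ι) (Y : ι → Matrix n n ℂ) (hY : ∀ c', c' ∉ S → Y c' = 0)
    {β' : ℝ} (hβ' : 0 ≤ β') (hYβ : ∀ c' ∈ S, ‖Y c'‖ ≤ β') : ‖Y‖ ≤ β' := by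
  refine (pi_norm_le_iff_of_nonneg hβ').2 fun b => ?_
  by_cases hb : b ∈ S
  · exact hYβ b hb
  · rw [hY b hb, norm_zero]; exact hβ'

omit [Nonempty n] in
/-- A field vanishing off `S` has sup norm at most its ℓ¹ norm on `S`. [folklore] -/
theorem pi_norm_le_sum_of_vanish {ι : Type*} [Fintype ι] (S : Finset ι) (Y : ι → Matrix n n ℂ) (hY : ∀ c', c' ∉ S → Y c' = 0) :
    ‖Y‖ ≤ ∑ c' ∈ S, ‖Y c'‖ := by
  refine (pi_norm_le_iff_of_nonneg (Finset.sum_nonneg fun _ _ => norm_nonneg _)).2 fun b => ?_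
  by_cases hb : b ∈ S
  · exact Finset.single_le_sum (f := fun c' => ‖Y c'‖) (fun _ _ => norm_nonneg _) hb
  · rw [hY b hb, norm_zero]; exact Finset.sum_nonneg fun _ _ => norm_nonneg _

/-- **THE `hT` LETTER OF ✓`ChartKernelTower.kernel_tower_bound_le` AT A CURVED BACKGROUND** (`θ₀ = 2L·L^{−d} + c_R`): for `Y` vanishing off a set `S` of readers of one site, `≤ β′` on `S`,
`‖Df(0)Y‖ ≤ (2L(Lᵈ)⁻¹ + 16(12Lρ)∕ρ²(2s_B))·β′`. [cite: Balaban1985Averaging, (139)-(142) p.39, (152)-(154) pp.40-41] -/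
theorem norm_fderiv_chart_le_of_endpoint (hj : j + 1 ≤ P.m + P.K) (c : PBond P (j + 1)) (V₀ : GaugeField P j (Matrix n n ℂ)ˣ)
    (û : GaugeTransf P j (Matrix n n ℂ)ˣ)
    (hû : ∀ x, ‖((û x : (Matrix n n ℂ)ˣ) : Matrix n n ℂ)‖ ≤ 1) (hû' : ∀ x, ‖(((û x)⁻¹ : (Matrix n n ℂ)ˣ) : Matrix n n ℂ)‖ ≤ 1) {sB ρ : ℝ} (hρ0 : 0 < ρ)
    (hbudget : 10000000 * (((P.d + 2) * P.L : ℕ) : ℝ) ^ 2 * ρ ≤ 1) (hsB0 : 0 ≤ sB) (hsB : 4 * sB < ρ)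
    (hV : ∀ b : PBond P j, (blockOf b.src = c.src ∨ blockOf b.src = c.tgt) → (blockOf b.tgt = c.src ∨ blockOf b.tgt = c.tgt) →
      ‖((gaugeActT û V₀ b : (Matrix n n ℂ)ˣ) : Matrix n n ℂ) - 1‖ ≤ sB)
    (βs : Site P j) (S : Finset (PBond P j)) (hS : ∀ c' ∈ S, c'.src = βs ∨ c'.tgt = βs)
    (Y : PBond P j → Matrix n n ℂ) (hY : ∀ c', c' ∉ S → Y c' = 0) {β' : ℝ} (hβ' : 0 ≤ β') (hYβ : ∀ c' ∈ S, ‖Y c'‖ ≤ β') :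
    ‖fderiv ℂ (fun A : PBond P j → Matrix n n ℂ =>
          mlog (((dbarCovU V₀ (fun b => expUnit (A b) * V₀ b) c : (Matrix n n ℂ)ˣ) : Matrix n n ℂ) * (((emlAvgU V₀ c)⁻¹ : (Matrix n n ℂ)ˣ) : Matrix n n ℂ))) 0 Y‖ ≤
      (2 * (P.L : ℝ) * ((P.L : ℝ) ^ P.d)⁻¹ + 16 * (12 * (P.L : ℝ) * ρ) / ρ ^ 2 * (2 * sB)) * β' := by
  have h1 := norm_fderiv_chart_sub_conjTube_le hj c V₀ û hû hû' hρ0 hbudget hsB0 hsB hV Y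
  have h2 := norm_conjTube_le_of_endpoint hj û hû hû' (emb c.src) βs S hS Y hY hβ' hYβ c
  have h3 : ‖Y‖ ≤ β' := pi_norm_le_of_vanish S Y hY hβ' hYβ
  have hK : 0 ≤ 16 * (12 * (P.L : ℝ) * ρ) / ρ ^ 2 * (2 * sB) := by positivity
  calc _ = ‖(_ - _) + _‖ := by rw [sub_add_cancel]
    _ ≤ ‖_ - _‖ + ‖_‖ := norm_add_le _ _
    _ ≤ 16 * (12 * (P.L : ℝ) * ρ) / ρ ^ 2 * (2 * sB) * ‖Y‖ + 2 * (P.L : ℝ) * ((P.L : ℝ) ^ P.d)⁻¹ * β' := add_le_add h1 h2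
    _ ≤ 16 * (12 * (P.L : ℝ) * ρ) / ρ ^ 2 * (2 * sB) * β' + 2 * (P.L : ℝ) * ((P.L : ℝ) ^ P.d)⁻¹ * β' := by gcongr
    _ = (2 * (P.L : ℝ) * ((P.L : ℝ) ^ P.d)⁻¹ + 16 * (12 * (P.L : ℝ) * ρ) / ρ ^ 2 * (2 * sB)) * β' := by ring

/-- **THE `hR` LETTER OF ✓`LeakyLinearTower.leaky_tower_bound` (ℓ¹ FORM OF THE LEAK)**: for `Y` vanishing off `S`,
`‖Df(0)Y − T♭Y‖ ≤ 16(12Lρ)∕ρ²(2s_B)·Σ_{c′ ∈ S} ‖Y c′‖` (`c_R := 16(12Lρ)∕ρ²·(2s_B)`). [cite: Balaban1985Averaging, (139) p.39, (152) p.40] -/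
theorem norm_fderiv_chart_sub_conjTube_le_sum (hj : j + 1 ≤ P.m + P.K) (c : PBond P (j + 1)) (V₀ : GaugeField P j (Matrix n n ℂ)ˣ)
    (û : GaugeTransf P j (Matrix n n ℂ)ˣ)
    (hû : ∀ x, ‖((û x : (Matrix n n ℂ)ˣ) : Matrix n n ℂ)‖ ≤ 1) (hû' : ∀ x, ‖(((û x)⁻¹ : (Matrix n n ℂ)ˣ) : Matrix n n ℂ)‖ ≤ 1) {sB ρ : ℝ} (hρ0 : 0 < ρ)
    (hbudget : 10000000 * (((P.d + 2) * P.L : ℕ) : ℝ) ^ 2 * ρ ≤ 1) (hsB0 : 0 ≤ sB) (hsB : 4 * sB < ρ)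
    (hV : ∀ b : PBond P j, (blockOf b.src = c.src ∨ blockOf b.src = c.tgt) → (blockOf b.tgt = c.src ∨ blockOf b.tgt = c.tgt) →
      ‖((gaugeActT û V₀ b : (Matrix n n ℂ)ˣ) : Matrix n n ℂ) - 1‖ ≤ sB)
    (S : Finset (PBond P j)) (Y : PBond P j → Matrix n n ℂ) (hY : ∀ c', c' ∉ S → Y c' = 0) :
    ‖fderiv ℂ (fun A : PBond P j → Matrix n n ℂ =>
          mlog (((dbarCovU V₀ (fun b => expUnit (A b) * V₀ b) c : (Matrix n n ℂ)ˣ) : Matrix n n ℂ) * (((emlAvgU V₀ c)⁻¹ : (Matrix n n ℂ)ˣ) : Matrix n n ℂ))) 0 Y -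
        (((û (emb c.src))⁻¹ : (Matrix n n ℂ)ˣ) : Matrix n n ℂ) *
          (((P.L : ℕ) : ℂ) • bondAvg (fun b : PBond P j => ((û b.src : (Matrix n n ℂ)ˣ) : Matrix n n ℂ) * Y b * (((û b.src)⁻¹ : (Matrix n n ℂ)ˣ) : Matrix n n ℂ)) c) *
          ((û (emb c.src) : (Matrix n n ℂ)ˣ) : Matrix n n ℂ)‖ ≤
      16 * (12 * (P.L : ℝ) * ρ) / ρ ^ 2 * (2 * sB) * ∑ c' ∈ S, ‖Y c'‖ := by
  have hK : 0 ≤ 16 * (12 * (P.L : ℝ) * ρ) / ρ ^ 2 * (2 * sB) := by positivity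
  exact (norm_fderiv_chart_sub_conjTube_le hj c V₀ û hû hû' hρ0 hbudget hsB0 hsB hV Y).trans
    (mul_le_mul_of_nonneg_left (pi_norm_le_sum_of_vanish S Y hY) hK)

end Generic

/-! ## §2 The SU(2) background tower of a plaquette-small field, in the cluster axial gauges -/

section SU2

/-- ★★ **THE SPLIT AT LEVEL `l` OF THE TOWER `Ū₀ˡ = emlIterU l U₀♭` OF A PLAQUETTE-SMALL SU(2) BACKGROUND** (field-valued `fderiv`, ★routeR-w6's cluster axial gauge
`û_c := transfUp (axialT U₀ (embIter (l+1) c₋))♭ l`, `s_B := s₀(l) = 30ℓLˡ·2d(3L^{l+1} − 1)a₀`, budgets `6400ℓ²Lˡs_B ≤ 1`, `10⁷ℓ²ρ ≤ 1`, `4s₀(l) < ρ`): for every `Y` and `c`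
`‖(D f_l(0)Y)(c) − û_c(emb c₋)⁻¹·(L·Q(Ad_{û_c}Y))(c)·û_c(emb c₋)‖ ≤ 16(12Lρ)∕ρ²·(2s₀(l))·‖Y‖`. [cite: Balaban1985Averaging, (11)-(12) p.19, (124)-(127) p.36, (139) p.39, (161)-(163) p.42] -/
theorem norm_fderiv_chartField_apply_sub_conjTube_le_of_plaqSmall {l : ℕ} (hl : l + 2 ≤ P.m + P.K) (U₀ : GaugeField P 0 (Matrix.specialUnitaryGroup (Fin 2) ℂ))
    {a₀ : ℝ} (ha₀ : 0 < a₀) (hU : PlaqSmall a₀ U₀)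
    (hbud₀ : 6400 * (((P.d + 2) * P.L : ℕ) : ℝ) ^ 2 * (P.L : ℝ) ^ l * (2 * ((P.d : ℝ) * (3 * (P.L : ℝ) ^ (l + 1) - 1)) * a₀) ≤ 1)
    {ρ : ℝ} (hρ0 : 0 < ρ) (hbudget : 10000000 * (((P.d + 2) * P.L : ℕ) : ℝ) ^ 2 * ρ ≤ 1)
    (hs₀ρ : 4 * (30 * (((P.d + 2) * P.L : ℕ) : ℝ) * (P.L : ℝ) ^ l * (2 * ((P.d : ℝ) * (3 * (P.L : ℝ) ^ (l + 1) - 1)) * a₀)) < ρ)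
    (Y : PBond P l → Matrix (Fin 2) (Fin 2) ℂ) (c : PBond P (l + 1)) :
    ‖(fderiv ℂ (fun (y : PBond P l → Matrix (Fin 2) (Fin 2) ℂ) (c : PBond P (l + 1)) =>
          mlog (((dbarCovU (emlIterU l (unitsField (toUField U₀))) (fun b => expUnit (y b) * emlIterU l (unitsField (toUField U₀)) b) c :
              (Matrix (Fin 2) (Fin 2) ℂ)ˣ) : Matrix (Fin 2) (Fin 2) ℂ) *
            (((emlAvgU (emlIterU l (unitsField (toUField U₀))) c)⁻¹ : (Matrix (Fin 2) (Fin 2) ℂ)ˣ) : Matrix (Fin 2) (Fin 2) ℂ))) 0 Y) c -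
        ((((transfUp (fun x => Unitary.toUnits (suIncl (axialT U₀ (embIter (l + 1) c.src) x)) : GaugeTransf P 0 (Matrix (Fin 2) (Fin 2) ℂ)ˣ) l)
              (emb c.src))⁻¹ : (Matrix (Fin 2) (Fin 2) ℂ)ˣ) : Matrix (Fin 2) (Fin 2) ℂ) *
          (((P.L : ℕ) : ℂ) • bondAvg (fun b : PBond P l =>
              (((transfUp (fun x => Unitary.toUnits (suIncl (axialT U₀ (embIter (l + 1) c.src) x)) : GaugeTransf P 0 (Matrix (Fin 2) (Fin 2) ℂ)ˣ) l) b.src :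
                  (Matrix (Fin 2) (Fin 2) ℂ)ˣ) : Matrix (Fin 2) (Fin 2) ℂ) * Y b *
              ((((transfUp (fun x => Unitary.toUnits (suIncl (axialT U₀ (embIter (l + 1) c.src) x)) : GaugeTransf P 0 (Matrix (Fin 2) (Fin 2) ℂ)ˣ) l) b.src)⁻¹ :
                  (Matrix (Fin 2) (Fin 2) ℂ)ˣ) : Matrix (Fin 2) (Fin 2) ℂ)) c) *
          (((transfUp (fun x => Unitary.toUnits (suIncl (axialT U₀ (embIter (l + 1) c.src) x)) : GaugeTransf P 0 (Matrix (Fin 2) (Fin 2) ℂ)ˣ) l) (emb c.src) :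
              (Matrix (Fin 2) (Fin 2) ℂ)ˣ) : Matrix (Fin 2) (Fin 2) ℂ)‖ ≤
      16 * (12 * (P.L : ℝ) * ρ) / ρ ^ 2 * (2 * (30 * (((P.d + 2) * P.L : ℕ) : ℝ) * (P.L : ℝ) ^ l * (2 * ((P.d : ℝ) * (3 * (P.L : ℝ) ^ (l + 1) - 1)) * a₀))) * ‖Y‖ := by
  have hL1 : (1 : ℝ) ≤ P.L := by exact_mod_cast P.L_pos
  have hsB0 : 0 ≤ 30 * (((P.d + 2) * P.L : ℕ) : ℝ) * (P.L : ℝ) ^ l * (2 * ((P.d : ℝ) * (3 * (P.L : ℝ) ^ (l + 1) - 1)) * a₀) := by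
    have h3 : (0 : ℝ) ≤ 3 * (P.L : ℝ) ^ (l + 1) - 1 := by linarith [one_le_pow₀ (n := l + 1) hL1]
    have ha := ha₀.le
    positivity
  set û : PBond P (l + 1) → GaugeTransf P l (Matrix (Fin 2) (Fin 2) ℂ)ˣ := fun c =>
    (transfUp (fun x => Unitary.toUnits (suIncl (axialT U₀ (embIter (l + 1) c.src) x)) : GaugeTransf P 0 (Matrix (Fin 2) (Fin 2) ℂ)ˣ) l) with hû
  have hû1 : ∀ c x, ‖((û c x : (Matrix (Fin 2) (Fin 2) ℂ)ˣ) : Matrix (Fin 2) (Fin 2) ℂ)‖ ≤ 1 := fun c x => (norm_transfUp_toUnits_le_one _ l x).1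
  have hû2 : ∀ c x, ‖(((û c x)⁻¹ : (Matrix (Fin 2) (Fin 2) ℂ)ˣ) : Matrix (Fin 2) (Fin 2) ℂ)‖ ≤ 1 := fun c x => (norm_transfUp_toUnits_le_one _ l x).2
  have hV : ∀ (c : PBond P (l + 1)) (b : PBond P l), (blockOf b.src = c.src ∨ blockOf b.src = c.tgt) → (blockOf b.tgt = c.src ∨ blockOf b.tgt = c.tgt) →
      ‖((gaugeActT (û c) (emlIterU l (unitsField (toUField U₀))) b : (Matrix (Fin 2) (Fin 2) ℂ)ˣ) : Matrix (Fin 2) (Fin 2) ℂ) - 1‖ ≤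
        30 * (((P.d + 2) * P.L : ℕ) : ℝ) * (P.L : ℝ) ^ l * (2 * ((P.d : ℝ) * (3 * (P.L : ℝ) ^ (l + 1) - 1)) * a₀) :=
    fun c b h1 h2 => norm_bgTower_gauged_sub_one_le_of_plaqSmall hl U₀ ha₀ hU hbud₀ c b h1 h2
  have hl1 : l + 1 ≤ P.m + P.K := by omega
  have hcomp : ∀ c : PBond P (l + 1), DifferentiableAt ℂ (fun A : PBond P l → Matrix (Fin 2) (Fin 2) ℂ =>
      mlog (((dbarCovU (emlIterU l (unitsField (toUField U₀))) (fun b => expUnit (A b) * emlIterU l (unitsField (toUField U₀)) b) c :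
          (Matrix (Fin 2) (Fin 2) ℂ)ˣ) : Matrix (Fin 2) (Fin 2) ℂ) *
        (((emlAvgU (emlIterU l (unitsField (toUField U₀))) c)⁻¹ : (Matrix (Fin 2) (Fin 2) ℂ)ˣ) : Matrix (Fin 2) (Fin 2) ℂ))) 0 :=
    fun c => (differentiableAt_dbarLogRel_zero hl1 c _ (û c) (hû1 c) (hû2 c) hρ0 hbudget hsB0 hs₀ρ (hV c)).1
  rw [fderiv_pi hcomp]
  simp only [ContinuousLinearMap.pi_apply]
  exact norm_fderiv_chart_sub_conjTube_le hl1 c _ (û c) (hû1 c) (hû2 c) hρ0 hbudget hsB0 hs₀ρ (hV c) Y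

/-- Under the budgets every component of the field-valued one-step chart at `Ū₀ˡ` is differentiable at `0`, so the field-valued `fderiv` evaluated at `c` is the `fderiv` of the
`c`-component (`fderiv_pi`). [cite: Balaban1985Averaging, (127) p.36] -/
theorem fderiv_chartField_apply_eq_of_plaqSmall {l : ℕ} (hl : l + 2 ≤ P.m + P.K) (U₀ : GaugeField P 0 (Matrix.specialUnitaryGroup (Fin 2) ℂ))
    {a₀ : ℝ} (ha₀ : 0 < a₀) (hU : PlaqSmall a₀ U₀)
    (hbud₀ : 6400 * (((P.d + 2) * P.L : ℕ) : ℝ) ^ 2 * (P.L : ℝ) ^ l * (2 * ((P.d : ℝ) * (3 * (P.L : ℝ) ^ (l + 1) - 1)) * a₀) ≤ 1)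
    {ρ : ℝ} (hρ0 : 0 < ρ) (hbudget : 10000000 * (((P.d + 2) * P.L : ℕ) : ℝ) ^ 2 * ρ ≤ 1)
    (hs₀ρ : 4 * (30 * (((P.d + 2) * P.L : ℕ) : ℝ) * (P.L : ℝ) ^ l * (2 * ((P.d : ℝ) * (3 * (P.L : ℝ) ^ (l + 1) - 1)) * a₀)) < ρ)
    (Y : PBond P l → Matrix (Fin 2) (Fin 2) ℂ) (c : PBond P (l + 1)) :
    (fderiv ℂ (fun (y : PBond P l → Matrix (Fin 2) (Fin 2) ℂ) (c : PBond P (l + 1)) =>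
          mlog (((dbarCovU (emlIterU l (unitsField (toUField U₀))) (fun b => expUnit (y b) * emlIterU l (unitsField (toUField U₀)) b) c :
              (Matrix (Fin 2) (Fin 2) ℂ)ˣ) : Matrix (Fin 2) (Fin 2) ℂ) *
            (((emlAvgU (emlIterU l (unitsField (toUField U₀))) c)⁻¹ : (Matrix (Fin 2) (Fin 2) ℂ)ˣ) : Matrix (Fin 2) (Fin 2) ℂ))) 0 Y) c =
      fderiv ℂ (fun (y : PBond P l → Matrix (Fin 2) (Fin 2) ℂ) =>
          mlog (((dbarCovU (emlIterU l (unitsField (toUField U₀))) (fun b => expUnit (y b) * emlIterU l (unitsField (toUField U₀)) b) c :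
              (Matrix (Fin 2) (Fin 2) ℂ)ˣ) : Matrix (Fin 2) (Fin 2) ℂ) *
            (((emlAvgU (emlIterU l (unitsField (toUField U₀))) c)⁻¹ : (Matrix (Fin 2) (Fin 2) ℂ)ˣ) : Matrix (Fin 2) (Fin 2) ℂ))) 0 Y := by
  have hL1 : (1 : ℝ) ≤ P.L := by exact_mod_cast P.L_pos
  have hsB0 : 0 ≤ 30 * (((P.d + 2) * P.L : ℕ) : ℝ) * (P.L : ℝ) ^ l * (2 * ((P.d : ℝ) * (3 * (P.L : ℝ) ^ (l + 1) - 1)) * a₀) := by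
    have h3 : (0 : ℝ) ≤ 3 * (P.L : ℝ) ^ (l + 1) - 1 := by linarith [one_le_pow₀ (n := l + 1) hL1]
    have ha := ha₀.le
    positivity
  have hl1 : l + 1 ≤ P.m + P.K := by omega
  have hcomp : ∀ c : PBond P (l + 1), DifferentiableAt ℂ (fun A : PBond P l → Matrix (Fin 2) (Fin 2) ℂ =>
      mlog (((dbarCovU (emlIterU l (unitsField (toUField U₀))) (fun b => expUnit (A b) * emlIterU l (unitsField (toUField U₀)) b) c :
          (Matrix (Fin 2) (Fin 2) ℂ)ˣ) : Matrix (Fin 2) (Fin 2) ℂ) *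
        (((emlAvgU (emlIterU l (unitsField (toUField U₀))) c)⁻¹ : (Matrix (Fin 2) (Fin 2) ℂ)ˣ) : Matrix (Fin 2) (Fin 2) ℂ))) 0 :=
    fun c => (differentiableAt_dbarLogRel_zero hl1 c _ (transfUp (fun x => Unitary.toUnits (suIncl (axialT U₀ (embIter (l + 1) c.src) x)) : GaugeTransf P 0 (Matrix (Fin 2) (Fin 2) ℂ)ˣ) l)
      (fun x => (norm_transfUp_toUnits_le_one _ l x).1) (fun x => (norm_transfUp_toUnits_le_one _ l x).2) hρ0 hbudget hsB0 hs₀ρ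
      (fun b h1 h2 => norm_bgTower_gauged_sub_one_le_of_plaqSmall hl U₀ ha₀ hU hbud₀ c b h1 h2)).1
  rw [fderiv_pi hcomp]
  simp only [ContinuousLinearMap.pi_apply]

/-- **ORBIT-GROWTH LETTER AT LEVEL `l`**: `‖(D f_l(0)Y)(c)‖ ≤ (L + 16(12Lρ)∕ρ²(2s₀(l)))·‖Y‖`. [cite: Balaban1985Averaging, (124)-(127) p.36, (139) p.39] -/
theorem norm_fderiv_chartField_apply_le_mul_sup_of_plaqSmall {l : ℕ} (hl : l + 2 ≤ P.m + P.K) (U₀ : GaugeField P 0 (Matrix.specialUnitaryGroup (Fin 2) ℂ))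
    {a₀ : ℝ} (ha₀ : 0 < a₀) (hU : PlaqSmall a₀ U₀)
    (hbud₀ : 6400 * (((P.d + 2) * P.L : ℕ) : ℝ) ^ 2 * (P.L : ℝ) ^ l * (2 * ((P.d : ℝ) * (3 * (P.L : ℝ) ^ (l + 1) - 1)) * a₀) ≤ 1)
    {ρ : ℝ} (hρ0 : 0 < ρ) (hbudget : 10000000 * (((P.d + 2) * P.L : ℕ) : ℝ) ^ 2 * ρ ≤ 1)
    (hs₀ρ : 4 * (30 * (((P.d + 2) * P.L : ℕ) : ℝ) * (P.L : ℝ) ^ l * (2 * ((P.d : ℝ) * (3 * (P.L : ℝ) ^ (l + 1) - 1)) * a₀)) < ρ)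
    (Y : PBond P l → Matrix (Fin 2) (Fin 2) ℂ) (c : PBond P (l + 1)) :
    ‖(fderiv ℂ (fun (y : PBond P l → Matrix (Fin 2) (Fin 2) ℂ) (c : PBond P (l + 1)) =>
          mlog (((dbarCovU (emlIterU l (unitsField (toUField U₀))) (fun b => expUnit (y b) * emlIterU l (unitsField (toUField U₀)) b) c :
              (Matrix (Fin 2) (Fin 2) ℂ)ˣ) : Matrix (Fin 2) (Fin 2) ℂ) *
            (((emlAvgU (emlIterU l (unitsField (toUField U₀))) c)⁻¹ : (Matrix (Fin 2) (Fin 2) ℂ)ˣ) : Matrix (Fin 2) (Fin 2) ℂ))) 0 Y) c‖ ≤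
      ((P.L : ℝ) + 16 * (12 * (P.L : ℝ) * ρ) / ρ ^ 2 * (2 * (30 * (((P.d + 2) * P.L : ℕ) : ℝ) * (P.L : ℝ) ^ l * (2 * ((P.d : ℝ) * (3 * (P.L : ℝ) ^ (l + 1) - 1)) * a₀)))) * ‖Y‖ := by
  have hL1 : (1 : ℝ) ≤ P.L := by exact_mod_cast P.L_pos
  have hsB0 : 0 ≤ 30 * (((P.d + 2) * P.L : ℕ) : ℝ) * (P.L : ℝ) ^ l * (2 * ((P.d : ℝ) * (3 * (P.L : ℝ) ^ (l + 1) - 1)) * a₀) := by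
    have h3 : (0 : ℝ) ≤ 3 * (P.L : ℝ) ^ (l + 1) - 1 := by linarith [one_le_pow₀ (n := l + 1) hL1]
    have ha := ha₀.le
    positivity
  have hl1 : l + 1 ≤ P.m + P.K := by omega
  rw [fderiv_chartField_apply_eq_of_plaqSmall hl U₀ ha₀ hU hbud₀ hρ0 hbudget hs₀ρ Y c]
  exact norm_fderiv_chart_le_mul_sup hl1 c _ (transfUp (fun x => Unitary.toUnits (suIncl (axialT U₀ (embIter (l + 1) c.src) x)) : GaugeTransf P 0 (Matrix (Fin 2) (Fin 2) ℂ)ˣ) l)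
    (fun x => (norm_transfUp_toUnits_le_one _ l x).1) (fun x => (norm_transfUp_toUnits_le_one _ l x).2) hρ0 hbudget hsB0 hs₀ρ
    (fun b h1 h2 => norm_bgTower_gauged_sub_one_le_of_plaqSmall hl U₀ ha₀ hU hbud₀ c b h1 h2) Y

/-- **THE `hT`∕`θ₀` LETTER OF ✓`kernel_tower_bound_le` AT LEVEL `l`**: for `Y` vanishing off a set `S` of readers of one site, `≤ β′` on `S`,
`‖(D f_l(0)Y)(c)‖ ≤ (2L(Lᵈ)⁻¹ + 16(12Lρ)∕ρ²(2s₀(l)))·β′`. [cite: Balaban1985Averaging, (139)-(142) p.39, (152)-(154) pp.40-41] -/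
theorem norm_fderiv_chartField_apply_le_of_endpoint_of_plaqSmall {l : ℕ} (hl : l + 2 ≤ P.m + P.K) (U₀ : GaugeField P 0 (Matrix.specialUnitaryGroup (Fin 2) ℂ))
    {a₀ : ℝ} (ha₀ : 0 < a₀) (hU : PlaqSmall a₀ U₀)
    (hbud₀ : 6400 * (((P.d + 2) * P.L : ℕ) : ℝ) ^ 2 * (P.L : ℝ) ^ l * (2 * ((P.d : ℝ) * (3 * (P.L : ℝ) ^ (l + 1) - 1)) * a₀) ≤ 1)
    {ρ : ℝ} (hρ0 : 0 < ρ) (hbudget : 10000000 * (((P.d + 2) * P.L : ℕ) : ℝ) ^ 2 * ρ ≤ 1)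
    (hs₀ρ : 4 * (30 * (((P.d + 2) * P.L : ℕ) : ℝ) * (P.L : ℝ) ^ l * (2 * ((P.d : ℝ) * (3 * (P.L : ℝ) ^ (l + 1) - 1)) * a₀)) < ρ)
    (βs : Site P l) (S : Finset (PBond P l)) (hS : ∀ c' ∈ S, c'.src = βs ∨ c'.tgt = βs)
    (Y : PBond P l → Matrix (Fin 2) (Fin 2) ℂ) (hY : ∀ c', c' ∉ S → Y c' = 0) {β' : ℝ} (hβ' : 0 ≤ β') (hYβ : ∀ c' ∈ S, ‖Y c'‖ ≤ β')
    (c : PBond P (l + 1)) :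
    ‖(fderiv ℂ (fun (y : PBond P l → Matrix (Fin 2) (Fin 2) ℂ) (c : PBond P (l + 1)) =>
          mlog (((dbarCovU (emlIterU l (unitsField (toUField U₀))) (fun b => expUnit (y b) * emlIterU l (unitsField (toUField U₀)) b) c :
              (Matrix (Fin 2) (Fin 2) ℂ)ˣ) : Matrix (Fin 2) (Fin 2) ℂ) *
            (((emlAvgU (emlIterU l (unitsField (toUField U₀))) c)⁻¹ : (Matrix (Fin 2) (Fin 2) ℂ)ˣ) : Matrix (Fin 2) (Fin 2) ℂ))) 0 Y) c‖ ≤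
      (2 * (P.L : ℝ) * ((P.L : ℝ) ^ P.d)⁻¹ + 16 * (12 * (P.L : ℝ) * ρ) / ρ ^ 2 * (2 * (30 * (((P.d + 2) * P.L : ℕ) : ℝ) * (P.L : ℝ) ^ l * (2 * ((P.d : ℝ) * (3 * (P.L : ℝ) ^ (l + 1) - 1)) * a₀)))) * β' := by
  have hL1 : (1 : ℝ) ≤ P.L := by exact_mod_cast P.L_pos
  have hsB0 : 0 ≤ 30 * (((P.d + 2) * P.L : ℕ) : ℝ) * (P.L : ℝ) ^ l * (2 * ((P.d : ℝ) * (3 * (P.L : ℝ) ^ (l + 1) - 1)) * a₀) := by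
    have h3 : (0 : ℝ) ≤ 3 * (P.L : ℝ) ^ (l + 1) - 1 := by linarith [one_le_pow₀ (n := l + 1) hL1]
    have ha := ha₀.le
    positivity
  have hl1 : l + 1 ≤ P.m + P.K := by omega
  rw [fderiv_chartField_apply_eq_of_plaqSmall hl U₀ ha₀ hU hbud₀ hρ0 hbudget hs₀ρ Y c]
  exact norm_fderiv_chart_le_of_endpoint hl1 c _ (transfUp (fun x => Unitary.toUnits (suIncl (axialT U₀ (embIter (l + 1) c.src) x)) : GaugeTransf P 0 (Matrix (Fin 2) (Fin 2) ℂ)ˣ) l)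
    (fun x => (norm_transfUp_toUnits_le_one _ l x).1) (fun x => (norm_transfUp_toUnits_le_one _ l x).2) hρ0 hbudget hsB0 hs₀ρ
    (fun b h1 h2 => norm_bgTower_gauged_sub_one_le_of_plaqSmall hl U₀ ha₀ hU hbud₀ c b h1 h2) βs S hS Y hY hβ' hYβ

/-- **THE `hR`∕`c_R` LETTER OF ✓`leaky_tower_bound` AT LEVEL `l` (ℓ¹ FORM)**: for `Y` vanishing off `S`,
`‖(D f_l(0)Y)(c) − T♭_c Y‖ ≤ 16(12Lρ)∕ρ²(2s₀(l))·Σ_{c′ ∈ S} ‖Y c′‖`. [cite: Balaban1985Averaging, (139) p.39, (152) p.40] -/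
theorem norm_fderiv_chartField_apply_sub_conjTube_le_sum_of_plaqSmall {l : ℕ} (hl : l + 2 ≤ P.m + P.K) (U₀ : GaugeField P 0 (Matrix.specialUnitaryGroup (Fin 2) ℂ))
    {a₀ : ℝ} (ha₀ : 0 < a₀) (hU : PlaqSmall a₀ U₀)
    (hbud₀ : 6400 * (((P.d + 2) * P.L : ℕ) : ℝ) ^ 2 * (P.L : ℝ) ^ l * (2 * ((P.d : ℝ) * (3 * (P.L : ℝ) ^ (l + 1) - 1)) * a₀) ≤ 1)
    {ρ : ℝ} (hρ0 : 0 < ρ) (hbudget : 10000000 * (((P.d + 2) * P.L : ℕ) : ℝ) ^ 2 * ρ ≤ 1)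
    (hs₀ρ : 4 * (30 * (((P.d + 2) * P.L : ℕ) : ℝ) * (P.L : ℝ) ^ l * (2 * ((P.d : ℝ) * (3 * (P.L : ℝ) ^ (l + 1) - 1)) * a₀)) < ρ)
    (S : Finset (PBond P l)) (Y : PBond P l → Matrix (Fin 2) (Fin 2) ℂ) (hY : ∀ c', c' ∉ S → Y c' = 0) (c : PBond P (l + 1)) :
    ‖(fderiv ℂ (fun (y : PBond P l → Matrix (Fin 2) (Fin 2) ℂ) (c : PBond P (l + 1)) =>
          mlog (((dbarCovU (emlIterU l (unitsField (toUField U₀))) (fun b => expUnit (y b) * emlIterU l (unitsField (toUField U₀)) b) c :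
              (Matrix (Fin 2) (Fin 2) ℂ)ˣ) : Matrix (Fin 2) (Fin 2) ℂ) *
            (((emlAvgU (emlIterU l (unitsField (toUField U₀))) c)⁻¹ : (Matrix (Fin 2) (Fin 2) ℂ)ˣ) : Matrix (Fin 2) (Fin 2) ℂ))) 0 Y) c -
        (((((transfUp (fun x => Unitary.toUnits (suIncl (axialT U₀ (embIter (l + 1) c.src) x)) : GaugeTransf P 0 (Matrix (Fin 2) (Fin 2) ℂ)ˣ) l)
              (emb c.src))⁻¹ : (Matrix (Fin 2) (Fin 2) ℂ)ˣ) : Matrix (Fin 2) (Fin 2) ℂ) *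
          (((P.L : ℕ) : ℂ) • bondAvg (fun b : PBond P l =>
              (((transfUp (fun x => Unitary.toUnits (suIncl (axialT U₀ (embIter (l + 1) c.src) x)) : GaugeTransf P 0 (Matrix (Fin 2) (Fin 2) ℂ)ˣ) l) b.src :
                  (Matrix (Fin 2) (Fin 2) ℂ)ˣ) : Matrix (Fin 2) (Fin 2) ℂ) * Y b *
              ((((transfUp (fun x => Unitary.toUnits (suIncl (axialT U₀ (embIter (l + 1) c.src) x)) : GaugeTransf P 0 (Matrix (Fin 2) (Fin 2) ℂ)ˣ) l) b.src)⁻¹ :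
                  (Matrix (Fin 2) (Fin 2) ℂ)ˣ) : Matrix (Fin 2) (Fin 2) ℂ)) c) *
          (((transfUp (fun x => Unitary.toUnits (suIncl (axialT U₀ (embIter (l + 1) c.src) x)) : GaugeTransf P 0 (Matrix (Fin 2) (Fin 2) ℂ)ˣ) l) (emb c.src) :
              (Matrix (Fin 2) (Fin 2) ℂ)ˣ) : Matrix (Fin 2) (Fin 2) ℂ))‖ ≤
      16 * (12 * (P.L : ℝ) * ρ) / ρ ^ 2 * (2 * (30 * (((P.d + 2) * P.L : ℕ) : ℝ) * (P.L : ℝ) ^ l * (2 * ((P.d : ℝ) * (3 * (P.L : ℝ) ^ (l + 1) - 1)) * a₀))) * ∑ c' ∈ S, ‖Y c'‖ := by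
  have hL1 : (1 : ℝ) ≤ P.L := by exact_mod_cast P.L_pos
  have hsB0 : 0 ≤ 30 * (((P.d + 2) * P.L : ℕ) : ℝ) * (P.L : ℝ) ^ l * (2 * ((P.d : ℝ) * (3 * (P.L : ℝ) ^ (l + 1) - 1)) * a₀) := by
    have h3 : (0 : ℝ) ≤ 3 * (P.L : ℝ) ^ (l + 1) - 1 := by linarith [one_le_pow₀ (n := l + 1) hL1]
    have ha := ha₀.le
    positivity
  have hl1 : l + 1 ≤ P.m + P.K := by omega
  rw [fderiv_chartField_apply_eq_of_plaqSmall hl U₀ ha₀ hU hbud₀ hρ0 hbudget hs₀ρ Y c]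
  exact norm_fderiv_chart_sub_conjTube_le_sum hl1 c _ (transfUp (fun x => Unitary.toUnits (suIncl (axialT U₀ (embIter (l + 1) c.src) x)) : GaugeTransf P 0 (Matrix (Fin 2) (Fin 2) ℂ)ˣ) l)
    (fun x => (norm_transfUp_toUnits_le_one _ l x).1) (fun x => (norm_transfUp_toUnits_le_one _ l x).2) hρ0 hbudget hsB0 hs₀ρ
    (fun b h1 h2 => norm_bgTower_gauged_sub_one_le_of_plaqSmall hl U₀ ha₀ hU hbud₀ c b h1 h2) S Y hY

end SU2

end Summit.QuantumFields.YangMills.Theorems.Prop7CovKernelOneStep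

end
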